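import Literature.MathematicalPhysics.QuantumFieldTheory.Balaban1983to89.B11Eq174ChartRegimesLipschitzAtFlatW80LatticeFree
import Literature.MathematicalPhysics.QuantumFieldTheory.Balaban1983to89.B11Eq44COperatorTowerGeometric
import Literature.MathematicalPhysics.QuantumFieldTheory.Balaban1983to89.B9Thm311LaplaceAkPositiveDiagonal
import Literature.MathematicalPhysics.QuantumFieldTheory.Balaban1983to89.B9Thm311LaplaceAkPiPositiveDiagonal
import Literature.MathematicalPhysics.QuantumFieldTheory.Balaban1983to89.B9Thm311SitePrimeFormCoerciveTowerCanonical
import Literature.MathematicalPhysics.QuantumFieldTheory.Balaban1983to89.B9Eq326OperatorTowerRealityUnitary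
import Literature.MathematicalPhysics.QuantumFieldTheory.Balaban1983to89.B9Eq342GreenPrimeSupBound
import Literature.MathematicalPhysics.QuantumFieldTheory.Balaban1983to89.B7Eq43AveragedSmallnessLinearFeed
import Literature.MathematicalPhysics.QuantumFieldTheory.Balaban1983to89.B7Eq43AveragedSmallnessLevelFree
import Literature.MathematicalPhysics.QuantumFieldTheory.Balaban1983to89.B9Thm311SmallFieldClosed
import Literature.MathematicalPhysics.QuantumFieldTheory.Balaban1983to89.B11Eq98V0primeCurrentSlots
import Literature.MathematicalPhysics.QuantumFieldTheory.Balaban1983to89.B11Eq98CurrentSlot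
import Literature.MathematicalPhysics.QuantumFieldTheory.Balaban1983to89.B11Eq98V0LettersLatticeUniform

/-!
# `Balaban1983to89.B11Eq174ChartRegimesLipschitzAtFlatW80UnitaryClass` — T. Bałaban, *The variational problem and background fields in renormalization group method for
# lattice gauge theories*, Commun. Math. Phys. **102** (1985) 277–309 [Balaban1985Variational] Prop. 6 (116)–(121) p. 295, (174)–(175) p. 305, Prop. 4 (97)–(98)
# pp. 292–293, (44)–(47) p. 285, (27)–(28) p. 282; [Balaban1985BackgroundPropagators] (3.35)–(3.37) p. 396, Thm 3.11 p. 416, (3.122)–(3.126) p. 420, (3.153) p. 426,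
# Thm 3.13 p. 426; [Balaban1985Averaging] Prop. 2 (52)–(54) p. 26, Prop. 5 p. 42, Proposition 7 p. 43: **ONE `k`-LEVEL CHART WITH THE GENUINE (L3) SLOT ON PRINT's
# UNITARY SMALL-FIELD CLASS — ITS REGIMES AT `U` AND AT THE VACUUM AND ITS LIPSCHITZ MODULUS AT THE FLAT POINT, LATTICE-FREE, ABOUT THE SAME RADII** — the sibling
# `B11Eq174ChartRegimesLipschitzAtFlatW80LatticeFree` (this lineage, gen 106: the MODEL-block package) with EVERY model-block letter, the vacuum's witnesses, the slot's
# four letters (`ρ := rieszτ φ`, `(C_V, R_V) := (C_V(d, M_φ, α₀, ω, Ω), 1∕16)`, `J := Jcur U ∕ Jcur 1`, unitary levels), the realification basis of `𝔸` and [B7] Prop. 5's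
# complex numerics (HEIGHT-FREE on the diagonal) PRODUCED from print's class (`Ũ ∈ unitaryUnits 𝔸`, the bond ∕ all-direction ∕ plaquette ∕ gradient windows at `α`,
# the current window `‖J‖ ≤ j₀`) — the production of the cell's `Support/NE9CurChartTowerPiLipschitzAtFlatLatticeUniformClassW80` (p706024) re-run over the package:
# per lattice `∃ h52 hpos′ hposπ hpos₁` and `∃ C_G C₄ R′_w j_r a_r a_C` with the two W-slot regimes, the two Sect. C regimes, the radii bookkeeping, the fibre-map bounds
# on `‖B‖ < R_b`, and `‖ι(chart_U B) − chart_1 B‖ ≤ K·(j₀ + α)`.  A consumer gets (Ψ1)–(Ψ3) AND the modulus for ONE chart (`NE9B11ChartAnalytic.chartHB_triple_of_twoRegimes`).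
# NE9 crux-team LEAF PROVER 01 (`b2b-balaban-t4-ne9-formalise-leaf-01`), gen 106; cell `pub-balaban`∕`t4`, row NE9, bears_on R4/N22; composition BY NAME; [folklore].
WHAT IS PROVED (sorry-free; 0 `def`): **`exists_chartHB_W80_regimes_lipschitz_at_flat_unitaryClass`**.
HONEST SCOPE: composition BY NAME on the cell's MODEL rows (O-NE9-1; #5 UNRULED); constants crude and symbolic; `j₀`, `α` displayed separately; displayed = print's class,
the diagonal bookkeeping, the profile bounds, the numerics; nothing of [B11] Prop. 4, Prop. 6, (174)–(175), [B9] Thm 3.4 ∕ 3.11 ∕ 3.13 or [B7] Prop. 2 ∕ 5 ∕ 7 asserted as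
printed; «NE9 ⇐ the named binders»; NE9 NOT PRINTED ∕ NOT PROVED; spine PROVED 0∕9; rung (B)+1 finite T⁴ — NOT infinite volume, NOT mass gap, NOT BetaPertH, NOT Clay.
HONEST DEPENDENCY: continuum YM on T⁴ ⇐ BetaPertH ∧ nine spine estimates (0/9 proved); BetaPertH ⇐ (D1) ∧ (D4) ∧ CAP+tail; G-an2-4 gates asym, D1 and NE2/3/4.
NEW file; nothing modified.  Net new unproved facts: 0.
-/

noncomputable section

open Metric Set

namespace Literature.MathematicalPhysics.QuantumFieldTheory.Balaban1983to89.B11Eq174ChartRegimesLipschitzAtFlatW80UnitaryClass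

open scoped InnerProductSpace ComplexConjugate BigOperators
open B11Eq103H1Complex B11Eq115Space B11Eq174Chart
open B11Eq111FrakG (nabla115 jetLinearEquiv)  open B13Contraction113 (QuadAnalytic)
open B9SectCLatticeCarrier (Bond bpos btgt shift unshift)  open B4Sect5Torus (TSite)
open B7Prop1Explicit (U1 Wcx boxVec)  open B7Prop2Explicit (pdev AvgClosed C0 c2' unitaryUnits avgClosed_unitaryUnits unitaryUnits_le_U1 avgIter_zero)
open B7Prop3Flat (c3)  open B7Prop5GeneralLevels (thetaGen C3Gen)
open B7Prop5CplxLevels (epsCplx tauCplx C3Cplx)  open B9Eq315QTorus (perCfg cornerSite perSite perCfg_apply)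
open B9Eq315QTower (towerP UlevOf)  open B9Eq315QTowerFlat (perCfg_UlevOf_one_mem_U1 norm_Wcx_UlevOf_one_sub_one_le UlevOf_one QkW_one_surjective)
open B9Eq326OperatorTower (QkW QkW_surjective laplaceAk RofUk)  open B9Eq310HessianOperator (adTransportW hessOp)
open B9Eq310DeltaPrime (plaqHolU plaqHolU_one)  open B9Eq324DeltaPrimeATower (laplacePrimeAk)
open B9Eq3119DeltaPiTower (laplaceAkPi)  open B11Eq44COperatorTower (αT αT_le ulev_mem_U1_of_pdev C2T)
open B11Eq44COperatorTowerGeometric (ulev_reg_of_pdev_geometric geomProfile_nonneg geomProfile_le_αT sum_geomProfile_le)  open B11Eq44CLetterTower (Cck)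
open B9Thm311SmallFieldClosed (hRS_of_unitary)  open B9Eq315QTorusOnto (liftSite perSite_liftSite)
open B7Eq43AveragedSmallnessLevelFree (pdev_perCfg_le_of_plaq)  open B7Eq43AveragedSmallnessLinearFeed (twoWindows_linear_feed)
open B9Thm311SitePrimeFormCoerciveTowerCanonical (exists_strong_site_coercive_tower_diagonal)
open B9Thm311LaplaceAkPiPositiveDiagonal (exists_laplaceAkPi_pos_diagonal_closed)  open B9Thm311LaplaceAkPositiveDiagonal (exists_laplaceAk_pos_diagonal_closed)
open B9Eq326OperatorTowerRealityUnitary (UlevOf_star_eq_inv forall_star_eq_inv_of_mem)  open B9Eq342GreenPrimeSupBound (norm_adTransportW_eq)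
open B9Eq3119DeltaPiCarrier (currentCLM)  open B11Eq98V0primeCurrentSlots (rieszτ rieszτ_apply)
open B11Eq98CurrentSlot (Jcur)  open B11Eq28JcurWindow (norm_Jcur_le_of_window levWeight_three_le)
open B11Eq98V0LettersLatticeUniform (curV0_quadBound_lattice_uniform)  open B11Eq80Current (W80)
open B11Eq63V0GroupCurrent (curV0)  open B11Ineq88KernelLettersFlatChain (J_flat_le_zero)
open B11Eq174ChartRegimesLipschitzAtFlatW80LatticeFree (exists_chartHB_W80_regimes_lipschitz_at_flat_latticeFree)

variable {d : ℕ} (hd : 1 ≤ d) (L : ℕ) [NeZero L] (hL : 1 ≤ L) (hL2 : 2 ≤ L) (hL3 : 3 ≤ L) [Fact (0 < (L : ℝ))]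
  {𝔸 : Type*} [CStarAlgebra 𝔸] [Nontrivial 𝔸] [FiniteDimensional ℂ 𝔸]
  {W : Type*} [NormedAddCommGroup W] [InnerProductSpace ℂ W] [FiniteDimensional ℂ W] (φ : W ≃ₗ[ℂ] 𝔸)
  {Mφ Mφ' : ℝ} (hMφ : 0 ≤ Mφ) (hMφ' : 0 ≤ Mφ') (hφ : ∀ w, ‖φ w‖ ≤ Mφ * ‖w‖) (hφ' : ∀ X, ‖φ.symm X‖ ≤ Mφ' * ‖X‖)
  {a : ℝ} (ha : 0 < a) {a' : ℝ} (ha' : 0 < a')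
  (τ : 𝔸 →ₗ[ℂ] ℂ) {Cτ : ℝ} (hτ : ∀ X, ‖τ X‖ ≤ Cτ * ‖X‖) (hCτ : 0 ≤ Cτ) {Mτ : ℝ} (hτm : ∀ X Y : 𝔸, ‖τ (X * Y)‖ ≤ Mτ * ‖X‖ * ‖Y‖) (hMτ : 0 ≤ Mτ)
  {ρw : ℝ} (hρw : 0 ≤ ρw)
  (hτ₁ : ∀ X : 𝔸, τ (star X) = conj (τ X)) (hτ₂ : ∀ X Y : 𝔸, τ (X * Y) = τ (Y * X)) (hφτ : ∀ X Y : 𝔸, ⟪φ.symm X, φ.symm Y⟫_ℂ = τ (star X * Y))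
  {α₀ : ℝ} (hα₀ : 0 < α₀) (hα3 : C0 d * α₀ ≤ 1 / 3) (hα4 : 4 * α₀ ≤ c2' d L) (hα8 : 8 * α₀ ≤ c2' d L)
  (hαL : 50 * (d + 1) * αT d L α₀ * (L : ℝ) ^ d ≤ 1 / 2)
  {ρ : ℝ} (hρ0 : 0 < ρ) (hρ : Real.exp (4 * (800 * ((d : ℝ) + 1) ^ 2 * ((d : ℝ) + 4)) * α₀) * (1 + 8 * (131072 * ((d : ℝ) + 1) ^ 2) * ρ) ≤ 2)
  (hρ4 : 4 * ρ ≤ c3 d L) (hθ : 2 * d * thetaGen d L α₀ ≤ (L : ℝ) ^ 3 / 16) (hC3 : 2 * d * C3Gen d L * ρ ≤ 1)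
  (hCτ1 : Cτ ≤ 1) {ω Ω : ℝ} (hω1 : 1 ≤ ω) (hΩ1 : 1 ≤ Ω)
  {r' : ℝ} (hr' : 0 < r')
  (h7s' : Real.exp (4 * (800 * ((d : ℝ) + 1) ^ 2 * ((d : ℝ) + 4)) * α₀) * (1 + 8 * (131072 * ((d : ℝ) + 1) ^ 2) * r') ≤ 2)
  (h7c' : 2 * r' ≤ c3 d L) (h7r'1 : 409600 * ((d : ℝ) + 1) ^ 2 * r' ≤ 1)
  (h7s : Real.exp (4480 * ((d : ℝ) + 1) ^ 2 * ((d : ℝ) + 4) * α₀ + 240000 * ((d : ℝ) + 1) ^ 3 * r') * (1 + 8 * (2097152 * ((d : ℝ) + 1) ^ 2) * ρ) ≤ 2)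
  (h7c : 16 * ρ < c3 d L) (h7β : (d : ℝ) * C3Cplx d L * ρ ≤ 1)
  -- [B7] Prop. 5's complex numerics, HEIGHT-FREE (their values at `b′ := r′∕L^{n+1}`, `j = k = n+1` equal these)
  (h7E : epsCplx d L r' 0 ≤ 1 / 16) (h7dX : (d : ℝ) * (epsCplx d L r' 0 + tauCplx d L α₀ 0 r' 0) ≤ 1 / 16)

-- deep definitional unfolding `laplaceAkPi` ↦ `laplaceALatticeK … (π†Δπ) …` in the statement (as the host)
set_option maxRecDepth 8192 in
set_option maxHeartbeats 12800000 in -- the Lit face's ≈ 80-binder theorem applied once + the produced letters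
include hd hL2 hL3 hMφ hMφ' hφ hφ' ha ha' hτ hCτ hτm hMτ hρw hτ₁ hτ₂ hφτ hα₀ hα3 hα4 hα8 hαL hρ0 hρ hρ4 hθ hC3 hCτ1 hω1 hΩ1 hr' h7s' h7c' h7r'1 h7s h7c h7β h7E h7dX in
/-- **ONE `k`-LEVEL `cur U` CHART WITH THE GENUINE SLOT ON PRINT's UNITARY CLASS: REGIMES AT `U` AND AT THE VACUUM + LIPSCHITZ AT THE FLAT POINT, SAME RADII,
LATTICE-UNIFORMLY**: `∃ α₁ j₁ ε₄ ε_C R_b R_map K > 0` BEFORE `∀ n η m U`; `∃ h52 hpos′ hposπ hpos₁` PRODUCED; then the regime package and, for every `‖B‖ < R_b`,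
`‖ι(chart_U[W80(U)] B) − chart_1[W80(1)] B‖ ≤ K·(j₀ + α)`. [folklore]
[cite: Balaban1985Variational, Prop. 6 (116)–(121) p.295, (174)–(175) p.305, Prop. 4 (97)–(98) pp.292–293, (44)–(47) p.285, (27)–(28) p.282; Balaban1985BackgroundPropagators, (3.35)–(3.37) p.396, Thm 3.11 p.416, (3.122) p.420, (3.126) p.420, (3.153) p.426, Thm 3.13 p.426; Balaban1985Averaging, Prop. 2 (52)–(54) p.26, Prop. 5 p.42, Proposition 7 p.43] -/
theorem exists_chartHB_W80_regimes_lipschitz_at_flat_unitaryClass :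
    ∃ α₁ j₁ ε₄ εC Rb Rmap K : ℝ, 0 < α₁ ∧ 0 < j₁ ∧ 0 < ε₄ ∧ 0 < εC ∧ 0 < Rb ∧ 0 < Rmap ∧ 0 < K ∧
      ∀ (n : ℕ) (η : ℝ) [Fact (0 < η)] (hηL : η * (L : ℝ) ^ (n + 1) = 1) (c₀ c₁ : ℝ) [Fact (0 < c₀)] [Fact (0 < c₁)]
        (_hw : c₀ * ((L : ℝ) ^ (n + 1)) ^ d = c₁) (_hc₀η : c₀ = η ^ d) (_hρ : |η| ^ d / c₀ ≤ ρw) (m : Fin d → ℕ) [∀ i, NeZero (m i)] (_hm : ∀ i, 1 ≤ m i)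
        (U : Bond d (towerP L m (n + 1)) → 𝔸ˣ) (hUG : ∀ (x : B7Prop1Explicit.Site d) (κ : Fin d), perCfg (towerP L m (n + 1)) U x κ ∈ unitaryUnits 𝔸)
        (α : ℝ) (_hα : 0 ≤ α) (_hαle : α ≤ α₁) (_hUη : ∀ b, ‖(U b : 𝔸) - 1‖ ≤ α * η)
        (_hUw : ∀ (x : TSite d (towerP L m (n + 1))) (μ ν : Fin d), ‖(U (shift ν x, μ) : 𝔸) - (U (x, μ) : 𝔸)‖ ≤ α * η ^ 2)
        (_hpl : ∀ p : B9SectCLatticeCarrier.Plaq d (towerP L m (n + 1)), ‖(plaqHolU U p : 𝔸) - 1‖ ≤ α * η ^ 2)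
        (_hUgrad : ∀ (x : TSite d (towerP L m (n + 1))) (μ : Fin d), ‖(U (x, μ) : 𝔸) - U (unshift μ x, μ)‖ ≤ α * η ^ 2)
        (j₀ : ℝ) (_hJ : ∀ μ y, ‖B9Eq39Adjoint.J (fun μ => B9Eq33CovDerivVector.shiftEquiv μ) (fun μ y => U (y, μ)) η μ y‖ ≤ j₀) (_hj : j₀ ≤ j₁)
        (lev₀ : Bond d (towerP L m (n + 1)) → ℕ) (lev₁ : Bond d (towerP L m (n + 1)) × Fin d → ℕ) (levB : Bond d m → ℕ) (_hlev : ∀ b, n + 1 ≤ lev₀ b)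
        (_hw₀ : (NegSup.wSup (levWeight (L : ℝ) η lev₀ 1) : ℝ) ≤ ω) (_hw₁ : (NegSup.wSup (levWeight (L : ℝ) η lev₁ 2) : ℝ) ≤ ω)
        (_hw₃ : (NegSup.wInvSup (levWeight (L : ℝ) η lev₀ 3) : ℝ) ≤ Ω) (_hwB : (NegSup.wInvSup (levWeight (L : ℝ) η levB 0) : ℝ) ≤ Ω)
        (_hw₁' : (NegSup.wInvSup (levWeight (L : ℝ) η lev₁ 2) : ℝ) ≤ Ω),
      ∃ h52 : pdev (perCfg (towerP L m (n + 1)) U) < α₀ * (((L : ℝ) ^ (n + 1))⁻¹) ^ 2,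
      ∃ hpos' : ∀ x : SiteL2K ℂ d (towerP L m (n + 1)) c₀ W, x ≠ 0 →
          0 < RCLike.re ⟪x, laplacePrimeAk L m n φ η U a' (c₁ := c₁) x⟫_ℂ,
      ∃ hposπ : ∀ x : BondL2K ℂ d (towerP L m (n + 1)) c₀ W, x ≠ 0 →
          0 < RCLike.re ⟪x, laplaceAkPi L m n φ τ η U a' hpos' hL (fun j => αT d L α₀ * (((L : ℝ) ^ min (j + 1) (n + 1))⁻¹) ^ 2)
            (fun j => (geomProfile_le_αT (d := d) L (n + 1) hL hα₀.le j).trans (αT_le hL hα4))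
            (ulev_mem_U1_of_pdev L m (n + 1) U hL2 (avgClosed_unitaryUnits d L) hUG hα₀ hα3 hα4 h52)
            (ulev_reg_of_pdev_geometric L m (n + 1) U hL2 (avgClosed_unitaryUnits d L) hUG hα₀ hα3 hα4 h52) (c₁ := c₁) a x⟫_ℂ,
      ∃ hpos₁ : ∀ x : BondL2K ℂ d (towerP L m (n + 1)) c₀ W, x ≠ 0 →
          0 < RCLike.re ⟪x, laplaceAk L m n φ η (fun _ : Bond d (towerP L m (n + 1)) => (1 : 𝔸ˣ)) hL (fun _ => 0) (fun _ => by norm_num)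
            (perCfg_UlevOf_one_mem_U1 L m (n + 1)) (norm_Wcx_UlevOf_one_sub_one_le L m (n + 1) (fun _ => 0) (fun _ => le_rfl)) τ
            (c₀ := c₀) (c₁ := c₁) a x⟫_ℂ,
      ∃ CG C₄ R'w jr ar aC : ℝ, 0 ≤ jr ∧ 0 < ar ∧ ε₄ + ar ≤ aC ∧ R'w ≤ aC ∧ 1 / (1 - 4 * CG * C2T d α₀ * (εC + aC)) * (ε₄ + ar) ≤ Rmap ∧
        Regime (frakGLatticeCLM (lev₀ := lev₀) φ hposπ
              (QkW_surjective L m n φ U hL _ _ _ _ fun j => le_trans (mul_le_mul_of_nonneg_right (mul_le_mul_of_nonneg_left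
                (geomProfile_le_αT (d := d) L (n + 1) hL hα₀.le j) (by positivity)) (by positivity)) hαL) lev₁ (nabla115 η U)) 0
          (W80 (rieszτ φ) (LinearMap.toContinuousLinearMap τ) U (H1LatticeCLM (lev₀ := lev₀) (levB := levB) φ hposπ
                        (QkW_surjective L m n φ U hL _ _ _ _ fun j => le_trans (mul_le_mul_of_nonneg_right (mul_le_mul_of_nonneg_left
                          (geomProfile_le_αT (d := d) L (n + 1) hL hα₀.le j) (by positivity)) (by positivity)) hαL) lev₁ (nabla115 η U))
                        (Cck L m η (n + 1) U lev₀ lev₁ (nabla115 η U) levB) εC (Jcur (L := (L : ℝ)) (η := η) (lev₀ := lev₀) U)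
                        (currentCLM φ lev₁ (nabla115 η U)
                          (laplaceAkPi L m n φ τ η U a' hpos' hL (fun j => αT d L α₀ * (((L : ℝ) ^ min (j + 1) (n + 1))⁻¹) ^ 2)
                              (fun j => (geomProfile_le_αT (d := d) L (n + 1) hL hα₀.le j).trans (αT_le hL hα4))
                              (ulev_mem_U1_of_pdev L m (n + 1) U hL2 (avgClosed_unitaryUnits d L) hUG hα₀ hα3 hα4 h52)
                              (ulev_reg_of_pdev_geometric L m (n + 1) U hL2 (avgClosed_unitaryUnits d L) hUG hα₀ hα3 hα4 h52) (c₁ := c₁) a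
                            - LinearMap.adjoint (QkW L m n φ U hL (fun j => αT d L α₀ * (((L : ℝ) ^ min (j + 1) (n + 1))⁻¹) ^ 2)
                              (fun j => (geomProfile_le_αT (d := d) L (n + 1) hL hα₀.le j).trans (αT_le hL hα4))
                              (ulev_mem_U1_of_pdev L m (n + 1) U hL2 (avgClosed_unitaryUnits d L) hUG hα₀ hα3 hα4 h52)
                              (ulev_reg_of_pdev_geometric L m (n + 1) U hL2 (avgClosed_unitaryUnits d L) hUG hα₀ hα3 hα4 h52) (c₀ := c₀) (c₁ := c₁)) ∘ₗ
                                ((a : ℂ) • QkW L m n φ U hL (fun j => αT d L α₀ * (((L : ℝ) ^ min (j + 1) (n + 1))⁻¹) ^ 2)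
                              (fun j => (geomProfile_le_αT (d := d) L (n + 1) hL hα₀.le j).trans (αT_le hL hα4))
                              (ulev_mem_U1_of_pdev L m (n + 1) U hL2 (avgClosed_unitaryUnits d L) hUG hα₀ hα3 hα4 h52)
                              (ulev_reg_of_pdev_geometric L m (n + 1) U hL2 (avgClosed_unitaryUnits d L) hUG hα₀ hα3 hα4 h52) (c₀ := c₀) (c₁ := c₁))))) CG 0 C₄ R'w jr ar ε₄ ∧
        Regime (frakGLatticeCLM (L := (L : ℝ)) (η := η) (lev₀ := lev₀) (c := ((η : ℂ))⁻¹)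
              (R := adTransportW φ (fun _ : Bond d (towerP L m (n + 1)) => (1 : 𝔸ˣ)))
              (S := adTransportW φ fun _ : Bond d (towerP L m (n + 1)) => (1 : 𝔸ˣ)⁻¹) (Δ₁ := hessOp φ η (fun _ : Bond d (towerP L m (n + 1)) => (1 : 𝔸ˣ)) τ)
              (Rr := RofUk L m n φ η (fun _ : Bond d (towerP L m (n + 1)) => (1 : 𝔸ˣ)))
              (Q := (QkW L m n φ (fun _ : Bond d (towerP L m (n + 1)) => (1 : 𝔸ˣ)) hL (fun _ => 0) (fun _ => by norm_num)
                (perCfg_UlevOf_one_mem_U1 L m (n + 1)) (norm_Wcx_UlevOf_one_sub_one_le L m (n + 1) (fun _ => 0) (fun _ => le_rfl)) (c₀ := c₀) (c₁ := c₁))) (a := a)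
              φ hpos₁ (QkW_one_surjective L m hL n φ) lev₁ (nabla115 η (fun _ : Bond d (towerP L m (n + 1)) => (1 : 𝔸ˣ)))) 0
          (W80 (rieszτ φ) (LinearMap.toContinuousLinearMap τ) (fun _ : Bond d (towerP L m (n + 1)) => (1 : 𝔸ˣ))
                        (H1LatticeCLM (L := (L : ℝ)) (η := η) (lev₀ := lev₀) (levB := levB) (c := ((η : ℂ))⁻¹)
                        (R := adTransportW φ (fun _ : Bond d (towerP L m (n + 1)) => (1 : 𝔸ˣ)))
                        (S := adTransportW φ fun _ : Bond d (towerP L m (n + 1)) => (1 : 𝔸ˣ)⁻¹) (Δ₁ := hessOp φ η (fun _ : Bond d (towerP L m (n + 1)) => (1 : 𝔸ˣ)) τ)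
                        (Rr := RofUk L m n φ η (fun _ : Bond d (towerP L m (n + 1)) => (1 : 𝔸ˣ)))
                        (Q := (QkW L m n φ (fun _ : Bond d (towerP L m (n + 1)) => (1 : 𝔸ˣ)) hL (fun _ => 0) (fun _ => by norm_num)
                          (perCfg_UlevOf_one_mem_U1 L m (n + 1)) (norm_Wcx_UlevOf_one_sub_one_le L m (n + 1) (fun _ => 0) (fun _ => le_rfl)) (c₀ := c₀) (c₁ := c₁))) (a := a)
                        φ hpos₁ (QkW_one_surjective L m hL n φ) lev₁ (nabla115 η (fun _ : Bond d (towerP L m (n + 1)) => (1 : 𝔸ˣ))))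
                        (Cck L m η (n + 1) (fun _ : Bond d (towerP L m (n + 1)) => (1 : 𝔸ˣ)) lev₀ lev₁ (nabla115 η (fun _ : Bond d (towerP L m (n + 1)) => (1 : 𝔸ˣ))) levB) εC
                        (Jcur (L := (L : ℝ)) (η := η) (lev₀ := lev₀) (fun _ : Bond d (towerP L m (n + 1)) => (1 : 𝔸ˣ)))
                        (currentCLM φ lev₁ (nabla115 η (fun _ : Bond d (towerP L m (n + 1)) => (1 : 𝔸ˣ)))
                          (laplaceAk L m n φ η (fun _ : Bond d (towerP L m (n + 1)) => (1 : 𝔸ˣ)) hL (fun _ => 0) (fun _ => by norm_num)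
                              (perCfg_UlevOf_one_mem_U1 L m (n + 1)) (norm_Wcx_UlevOf_one_sub_one_le L m (n + 1) (fun _ => 0) (fun _ => le_rfl)) τ (c₀ := c₀) (c₁ := c₁) a
                            - LinearMap.adjoint (QkW L m n φ (fun _ : Bond d (towerP L m (n + 1)) => (1 : 𝔸ˣ)) hL (fun _ => 0) (fun _ => by norm_num)
                                (perCfg_UlevOf_one_mem_U1 L m (n + 1)) (norm_Wcx_UlevOf_one_sub_one_le L m (n + 1) (fun _ => 0) (fun _ => le_rfl)) (c₀ := c₀) (c₁ := c₁)) ∘ₗ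
                                ((a : ℂ) • (QkW L m n φ (fun _ : Bond d (towerP L m (n + 1)) => (1 : 𝔸ˣ)) hL (fun _ => 0) (fun _ => by norm_num)
                                  (perCfg_UlevOf_one_mem_U1 L m (n + 1)) (norm_Wcx_UlevOf_one_sub_one_le L m (n + 1) (fun _ => 0) (fun _ => le_rfl)) (c₀ := c₀) (c₁ := c₁)))))) CG 0 C₄ R'w jr ar ε₄ ∧
        Regime (H1LatticeCLM (lev₀ := lev₀) (levB := levB) φ hposπ
              (QkW_surjective L m n φ U hL _ _ _ _ fun j => le_trans (mul_le_mul_of_nonneg_right (mul_le_mul_of_nonneg_left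
                (geomProfile_le_αT (d := d) L (n + 1) hL hα₀.le j) (by positivity)) (by positivity)) hαL) lev₁ (nabla115 η U)) 0 (Cck L m η (n + 1) U lev₀ lev₁ (nabla115 η U) levB) CG 0 (C2T d α₀) ρ 0 aC εC ∧
        Regime (H1LatticeCLM (L := (L : ℝ)) (η := η) (lev₀ := lev₀) (levB := levB) (c := ((η : ℂ))⁻¹)
              (R := adTransportW φ (fun _ : Bond d (towerP L m (n + 1)) => (1 : 𝔸ˣ)))
              (S := adTransportW φ fun _ : Bond d (towerP L m (n + 1)) => (1 : 𝔸ˣ)⁻¹) (Δ₁ := hessOp φ η (fun _ : Bond d (towerP L m (n + 1)) => (1 : 𝔸ˣ)) τ)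
              (Rr := RofUk L m n φ η (fun _ : Bond d (towerP L m (n + 1)) => (1 : 𝔸ˣ)))
              (Q := (QkW L m n φ (fun _ : Bond d (towerP L m (n + 1)) => (1 : 𝔸ˣ)) hL (fun _ => 0) (fun _ => by norm_num)
                (perCfg_UlevOf_one_mem_U1 L m (n + 1)) (norm_Wcx_UlevOf_one_sub_one_le L m (n + 1) (fun _ => 0) (fun _ => le_rfl)) (c₀ := c₀) (c₁ := c₁))) (a := a)
              φ hpos₁ (QkW_one_surjective L m hL n φ) lev₁ (nabla115 η (fun _ : Bond d (towerP L m (n + 1)) => (1 : 𝔸ˣ)))) 0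
          (Cck L m η (n + 1) (fun _ : Bond d (towerP L m (n + 1)) => (1 : 𝔸ˣ)) lev₀ lev₁ (nabla115 η (fun _ : Bond d (towerP L m (n + 1)) => (1 : 𝔸ˣ))) levB) CG 0 (C2T d α₀) ρ 0 aC εC ∧
        (∀ B ∈ ball (0 : NegSize (L : ℝ) η levB 0 𝔸) Rb, ‖(H1LatticeCLM (lev₀ := lev₀) (levB := levB) φ hposπ
              (QkW_surjective L m n φ U hL _ _ _ _ fun j => le_trans (mul_le_mul_of_nonneg_right (mul_le_mul_of_nonneg_left
                (geomProfile_le_αT (d := d) L (n + 1) hL hα₀.le j) (by positivity)) (by positivity)) hαL) lev₁ (nabla115 η U)) B‖ < ar) ∧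
        (∀ B ∈ ball (0 : NegSize (L : ℝ) η levB 0 𝔸) Rb, ‖(H1LatticeCLM (L := (L : ℝ)) (η := η) (lev₀ := lev₀) (levB := levB) (c := ((η : ℂ))⁻¹)
              (R := adTransportW φ (fun _ : Bond d (towerP L m (n + 1)) => (1 : 𝔸ˣ)))
              (S := adTransportW φ fun _ : Bond d (towerP L m (n + 1)) => (1 : 𝔸ˣ)⁻¹) (Δ₁ := hessOp φ η (fun _ : Bond d (towerP L m (n + 1)) => (1 : 𝔸ˣ)) τ)
              (Rr := RofUk L m n φ η (fun _ : Bond d (towerP L m (n + 1)) => (1 : 𝔸ˣ)))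
              (Q := (QkW L m n φ (fun _ : Bond d (towerP L m (n + 1)) => (1 : 𝔸ˣ)) hL (fun _ => 0) (fun _ => by norm_num)
                (perCfg_UlevOf_one_mem_U1 L m (n + 1)) (norm_Wcx_UlevOf_one_sub_one_le L m (n + 1) (fun _ => 0) (fun _ => le_rfl)) (c₀ := c₀) (c₁ := c₁))) (a := a)
              φ hpos₁ (QkW_one_surjective L m hL n φ) lev₁ (nabla115 η (fun _ : Bond d (towerP L m (n + 1)) => (1 : 𝔸ˣ)))) B‖ < ar) ∧
        ∀ (B : NegSize (L : ℝ) η levB 0 𝔸), ‖B‖ < Rb →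
        ‖LinearMap.toContinuousLinearMap
              ((jetLinearEquiv (L : ℝ) η lev₀ lev₁ (nabla115 η (fun _ : Bond d (towerP L m (n + 1)) => (1 : 𝔸ˣ)))).symm.toLinearMap ∘ₗ
                (jetLinearEquiv (L : ℝ) η lev₀ lev₁ (nabla115 η U)).toLinearMap) (
            chartHB (frakGLatticeCLM (lev₀ := lev₀) φ hposπ
                  (QkW_surjective L m n φ U hL _ _ _ _ fun j => le_trans (mul_le_mul_of_nonneg_right (mul_le_mul_of_nonneg_left
                    (geomProfile_le_αT (d := d) L (n + 1) hL hα₀.le j) (by positivity)) (by positivity)) hαL) lev₁ (nabla115 η U))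
                0 (W80 (rieszτ φ) (LinearMap.toContinuousLinearMap τ) U (H1LatticeCLM (lev₀ := lev₀) (levB := levB) φ hposπ
                  (QkW_surjective L m n φ U hL _ _ _ _ fun j => le_trans (mul_le_mul_of_nonneg_right (mul_le_mul_of_nonneg_left
                    (geomProfile_le_αT (d := d) L (n + 1) hL hα₀.le j) (by positivity)) (by positivity)) hαL) lev₁ (nabla115 η U))
                  (Cck L m η (n + 1) U lev₀ lev₁ (nabla115 η U) levB) εC (Jcur (L := (L : ℝ)) (η := η) (lev₀ := lev₀) U)
                  (currentCLM φ lev₁ (nabla115 η U)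
                    (laplaceAkPi L m n φ τ η U a' hpos' hL (fun j => αT d L α₀ * (((L : ℝ) ^ min (j + 1) (n + 1))⁻¹) ^ 2)
                        (fun j => (geomProfile_le_αT (d := d) L (n + 1) hL hα₀.le j).trans (αT_le hL hα4))
                        (ulev_mem_U1_of_pdev L m (n + 1) U hL2 (avgClosed_unitaryUnits d L) hUG hα₀ hα3 hα4 h52)
                        (ulev_reg_of_pdev_geometric L m (n + 1) U hL2 (avgClosed_unitaryUnits d L) hUG hα₀ hα3 hα4 h52) (c₁ := c₁) a
                      - LinearMap.adjoint (QkW L m n φ U hL (fun j => αT d L α₀ * (((L : ℝ) ^ min (j + 1) (n + 1))⁻¹) ^ 2)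
                        (fun j => (geomProfile_le_αT (d := d) L (n + 1) hL hα₀.le j).trans (αT_le hL hα4))
                        (ulev_mem_U1_of_pdev L m (n + 1) U hL2 (avgClosed_unitaryUnits d L) hUG hα₀ hα3 hα4 h52)
                        (ulev_reg_of_pdev_geometric L m (n + 1) U hL2 (avgClosed_unitaryUnits d L) hUG hα₀ hα3 hα4 h52) (c₀ := c₀) (c₁ := c₁)) ∘ₗ
                          ((a : ℂ) • QkW L m n φ U hL (fun j => αT d L α₀ * (((L : ℝ) ^ min (j + 1) (n + 1))⁻¹) ^ 2)
                        (fun j => (geomProfile_le_αT (d := d) L (n + 1) hL hα₀.le j).trans (αT_le hL hα4))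
                        (ulev_mem_U1_of_pdev L m (n + 1) U hL2 (avgClosed_unitaryUnits d L) hUG hα₀ hα3 hα4 h52)
                        (ulev_reg_of_pdev_geometric L m (n + 1) U hL2 (avgClosed_unitaryUnits d L) hUG hα₀ hα3 hα4 h52) (c₀ := c₀) (c₁ := c₁))))) 0 (fun A' => A' + solA (H1LatticeCLM (lev₀ := lev₀) (levB := levB) φ hposπ
                  (QkW_surjective L m n φ U hL _ _ _ _ fun j => le_trans (mul_le_mul_of_nonneg_right (mul_le_mul_of_nonneg_left
                    (geomProfile_le_αT (d := d) L (n + 1) hL hα₀.le j) (by positivity)) (by positivity)) hαL) lev₁ (nabla115 η U)) 0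
                  (Cck L m η (n + 1) U lev₀ lev₁ (nabla115 η U) levB) 0 εC A') ε₄
                (H1LatticeCLM (lev₀ := lev₀) (levB := levB) φ hposπ
                  (QkW_surjective L m n φ U hL _ _ _ _ fun j => le_trans (mul_le_mul_of_nonneg_right (mul_le_mul_of_nonneg_left
                    (geomProfile_le_αT (d := d) L (n + 1) hL hα₀.le j) (by positivity)) (by positivity)) hαL) lev₁ (nabla115 η U)) B) -
          chartHB (frakGLatticeCLM (L := (L : ℝ)) (η := η) (lev₀ := lev₀) (c := ((η : ℂ))⁻¹)
              (R := adTransportW φ (fun _ : Bond d (towerP L m (n + 1)) => (1 : 𝔸ˣ)))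
              (S := adTransportW φ fun _ : Bond d (towerP L m (n + 1)) => (1 : 𝔸ˣ)⁻¹) (Δ₁ := hessOp φ η (fun _ : Bond d (towerP L m (n + 1)) => (1 : 𝔸ˣ)) τ)
              (Rr := RofUk L m n φ η (fun _ : Bond d (towerP L m (n + 1)) => (1 : 𝔸ˣ)))
              (Q := (QkW L m n φ (fun _ : Bond d (towerP L m (n + 1)) => (1 : 𝔸ˣ)) hL (fun _ => 0) (fun _ => by norm_num)
                (perCfg_UlevOf_one_mem_U1 L m (n + 1)) (norm_Wcx_UlevOf_one_sub_one_le L m (n + 1) (fun _ => 0) (fun _ => le_rfl)) (c₀ := c₀) (c₁ := c₁))) (a := a)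
              φ hpos₁ (QkW_one_surjective L m hL n φ) lev₁ (nabla115 η (fun _ : Bond d (towerP L m (n + 1)) => (1 : 𝔸ˣ)))) 0 (W80 (rieszτ φ) (LinearMap.toContinuousLinearMap τ) (fun _ : Bond d (towerP L m (n + 1)) => (1 : 𝔸ˣ))
              (H1LatticeCLM (L := (L : ℝ)) (η := η) (lev₀ := lev₀) (levB := levB) (c := ((η : ℂ))⁻¹)
              (R := adTransportW φ (fun _ : Bond d (towerP L m (n + 1)) => (1 : 𝔸ˣ)))
              (S := adTransportW φ fun _ : Bond d (towerP L m (n + 1)) => (1 : 𝔸ˣ)⁻¹) (Δ₁ := hessOp φ η (fun _ : Bond d (towerP L m (n + 1)) => (1 : 𝔸ˣ)) τ)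
              (Rr := RofUk L m n φ η (fun _ : Bond d (towerP L m (n + 1)) => (1 : 𝔸ˣ)))
              (Q := (QkW L m n φ (fun _ : Bond d (towerP L m (n + 1)) => (1 : 𝔸ˣ)) hL (fun _ => 0) (fun _ => by norm_num)
                (perCfg_UlevOf_one_mem_U1 L m (n + 1)) (norm_Wcx_UlevOf_one_sub_one_le L m (n + 1) (fun _ => 0) (fun _ => le_rfl)) (c₀ := c₀) (c₁ := c₁))) (a := a)
              φ hpos₁ (QkW_one_surjective L m hL n φ) lev₁ (nabla115 η (fun _ : Bond d (towerP L m (n + 1)) => (1 : 𝔸ˣ))))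
              (Cck L m η (n + 1) (fun _ : Bond d (towerP L m (n + 1)) => (1 : 𝔸ˣ)) lev₀ lev₁ (nabla115 η (fun _ : Bond d (towerP L m (n + 1)) => (1 : 𝔸ˣ))) levB) εC
              (Jcur (L := (L : ℝ)) (η := η) (lev₀ := lev₀) (fun _ : Bond d (towerP L m (n + 1)) => (1 : 𝔸ˣ)))
              (currentCLM φ lev₁ (nabla115 η (fun _ : Bond d (towerP L m (n + 1)) => (1 : 𝔸ˣ)))
                (laplaceAk L m n φ η (fun _ : Bond d (towerP L m (n + 1)) => (1 : 𝔸ˣ)) hL (fun _ => 0) (fun _ => by norm_num)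
                    (perCfg_UlevOf_one_mem_U1 L m (n + 1)) (norm_Wcx_UlevOf_one_sub_one_le L m (n + 1) (fun _ => 0) (fun _ => le_rfl)) τ (c₀ := c₀) (c₁ := c₁) a
                  - LinearMap.adjoint (QkW L m n φ (fun _ : Bond d (towerP L m (n + 1)) => (1 : 𝔸ˣ)) hL (fun _ => 0) (fun _ => by norm_num)
                      (perCfg_UlevOf_one_mem_U1 L m (n + 1)) (norm_Wcx_UlevOf_one_sub_one_le L m (n + 1) (fun _ => 0) (fun _ => le_rfl)) (c₀ := c₀) (c₁ := c₁)) ∘ₗ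
                      ((a : ℂ) • (QkW L m n φ (fun _ : Bond d (towerP L m (n + 1)) => (1 : 𝔸ˣ)) hL (fun _ => 0) (fun _ => by norm_num)
                        (perCfg_UlevOf_one_mem_U1 L m (n + 1)) (norm_Wcx_UlevOf_one_sub_one_le L m (n + 1) (fun _ => 0) (fun _ => le_rfl)) (c₀ := c₀) (c₁ := c₁)))))) 0
            (fun A' => A' + solA (H1LatticeCLM (L := (L : ℝ)) (η := η) (lev₀ := lev₀) (levB := levB) (c := ((η : ℂ))⁻¹)
              (R := adTransportW φ (fun _ : Bond d (towerP L m (n + 1)) => (1 : 𝔸ˣ)))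
              (S := adTransportW φ fun _ : Bond d (towerP L m (n + 1)) => (1 : 𝔸ˣ)⁻¹) (Δ₁ := hessOp φ η (fun _ : Bond d (towerP L m (n + 1)) => (1 : 𝔸ˣ)) τ)
              (Rr := RofUk L m n φ η (fun _ : Bond d (towerP L m (n + 1)) => (1 : 𝔸ˣ)))
              (Q := (QkW L m n φ (fun _ : Bond d (towerP L m (n + 1)) => (1 : 𝔸ˣ)) hL (fun _ => 0) (fun _ => by norm_num)
                (perCfg_UlevOf_one_mem_U1 L m (n + 1)) (norm_Wcx_UlevOf_one_sub_one_le L m (n + 1) (fun _ => 0) (fun _ => le_rfl)) (c₀ := c₀) (c₁ := c₁))) (a := a)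
              φ hpos₁ (QkW_one_surjective L m hL n φ) lev₁ (nabla115 η (fun _ : Bond d (towerP L m (n + 1)) => (1 : 𝔸ˣ)))) 0
              (Cck L m η (n + 1) (fun _ : Bond d (towerP L m (n + 1)) => (1 : 𝔸ˣ)) lev₀ lev₁ (nabla115 η (fun _ : Bond d (towerP L m (n + 1)) => (1 : 𝔸ˣ))) levB) 0 εC A') ε₄
            (H1LatticeCLM (L := (L : ℝ)) (η := η) (lev₀ := lev₀) (levB := levB) (c := ((η : ℂ))⁻¹)
              (R := adTransportW φ (fun _ : Bond d (towerP L m (n + 1)) => (1 : 𝔸ˣ)))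
              (S := adTransportW φ fun _ : Bond d (towerP L m (n + 1)) => (1 : 𝔸ˣ)⁻¹) (Δ₁ := hessOp φ η (fun _ : Bond d (towerP L m (n + 1)) => (1 : 𝔸ˣ)) τ)
              (Rr := RofUk L m n φ η (fun _ : Bond d (towerP L m (n + 1)) => (1 : 𝔸ˣ)))
              (Q := (QkW L m n φ (fun _ : Bond d (towerP L m (n + 1)) => (1 : 𝔸ˣ)) hL (fun _ => 0) (fun _ => by norm_num)
                (perCfg_UlevOf_one_mem_U1 L m (n + 1)) (norm_Wcx_UlevOf_one_sub_one_le L m (n + 1) (fun _ => 0) (fun _ => le_rfl)) (c₀ := c₀) (c₁ := c₁))) (a := a)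
              φ hpos₁ (QkW_one_surjective L m hL n φ) lev₁ (nabla115 η (fun _ : Bond d (towerP L m (n + 1)) => (1 : 𝔸ˣ)))) B‖ ≤
          K * (j₀ + α) := by
  classical
  have hL0 : (0 : ℝ) < L := by exact_mod_cast lt_of_lt_of_le (by norm_num) hL2
  have hL1 : (1 : ℝ) ≤ (L : ℝ) := by exact_mod_cast hL
  have hr0 : (0 : ℝ) ≤ 1 / (L : ℝ) := by positivity
  have hr1 : 1 / (L : ℝ) < 1 := by rw [div_lt_one hL0]; exact_mod_cast lt_of_lt_of_le (by norm_num) hL2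
  have hstar : ∀ X : 𝔸, ‖star X‖ ≤ ‖X‖ := fun X => (norm_star X).le
  have hω : 0 ≤ ω := zero_le_one.trans hω1
  have hΩ : 0 ≤ Ω := zero_le_one.trans hΩ1
  -- the realification basis of `𝔸` with its coordinate bound `M₂ := Σ_i ‖coord_i‖` (Prop. 7's Cauchy estimates are read in real coordinates)
  obtain ⟨M₂, hM₂, hrepr⟩ : ∃ M₂ : ℝ, 0 ≤ M₂ ∧ ∀ (v : 𝔸) (i : Fin (Module.finrank ℝ 𝔸)), |(Module.finBasis ℝ 𝔸).repr v i| ≤ M₂ * ‖v‖ := by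
    refine ⟨∑ i, ‖LinearMap.toContinuousLinearMap ((Module.finBasis ℝ 𝔸).coord i)‖, Finset.sum_nonneg fun i _ => norm_nonneg _, fun v i => ?_⟩
    have h1 : |(Module.finBasis ℝ 𝔸).repr v i| = ‖LinearMap.toContinuousLinearMap ((Module.finBasis ℝ 𝔸).coord i) v‖ := rfl
    rw [h1]
    exact (ContinuousLinearMap.le_opNorm _ v).trans (mul_le_mul_of_nonneg_right (Finset.single_le_sum
      (fun j _ => norm_nonneg (LinearMap.toContinuousLinearMap ((Module.finBasis ℝ 𝔸).coord j))) (Finset.mem_univ i)) (norm_nonneg v))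
  -- the lattice-free V₀-letter `C_V` (leaf-05) at `‖ρ‖ ≤ M_φ²`, `‖τ‖ ≤ 1`, `α ≤ α₀`
  obtain ⟨CV, hCVdef⟩ : ∃ CV : ℝ, CV = 1024 * ((d - 1 : ℕ) : ℝ) * (ω * Ω) ^ 3 * (Mφ * Mφ) * (α₀ * 1 * ω ^ 2 + 1 / 16)
      + ((d - 1 : ℕ) : ℝ) * (ω * Ω) ^ 3 * (136 + 2 * (ω * Ω)) * (Mφ * Mφ) * 1 := ⟨_, rfl⟩
  have hCV : 0 ≤ CV := by rw [hCVdef]; positivity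
  -- (0) the Lit face, `∃`-first, at `ϱ := 1∕L`, `AQ := αT∕3`, `G := unitaryUnits 𝔸`, `(C_V, R_V, M_ρ, M_J) := (C_V, 1∕16, M_φ², ω³)`
  obtain ⟨αF, j₁, ε₄, εC, Rb, Rmap, KF, hαF, hj₁, hε₄, hεC, hRb, hRmap, hKF, HF⟩ :=
    exists_chartHB_W80_regimes_lipschitz_at_flat_latticeFree hd L hL hL2 hL3 φ hMφ hMφ' hφ hφ' hstar ha ha' hr0 hr1 τ hτ hCτ hτm hMτ hρw hτ₁ hτ₂ hφτ
      (αT d L α₀ / 3) (Module.finBasis ℝ 𝔸) hM₂ hrepr (avgClosed_unitaryUnits d L) hα₀ hα3 hα4 hα8 hρ0 hρ hρ4 hθ hC3 hω1 hΩ1 hr' h7s' h7c' h7r'1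
      h7s h7c h7β (CV := CV) (RV := 1 / 16) (Mρ := Mφ * Mφ) (MJ := ω ^ 3) hCV (by norm_num) le_rfl (mul_nonneg hMφ hMφ) (by positivity)
  obtain ⟨αS, γ', hαS, hγ', HS⟩ := exists_strong_site_coercive_tower_diagonal (d := d) L φ hMφ hMφ' hφ hφ' ha' hr0 hr1
  obtain ⟨αQ, hαQ, HQ⟩ := exists_laplaceAkPi_pos_diagonal_closed (d := d) L hL φ hMφ hMφ' hφ hφ' ha ha' hr0 hr1 τ hτ hCτ hρw
  obtain ⟨αA, hαA, HA⟩ := exists_laplaceAk_pos_diagonal_closed (d := d) L hL φ hMφ hMφ' hφ hφ' ha hr0 hr1 τ hτ hCτ hρw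
  -- the α-linear two-window feed below the least threshold and below `1` (for the levels `ε_j ≤ 1`)
  obtain ⟨T, hT, F⟩ := twoWindows_linear_feed L hL2 (d := d) (𝔸 := 𝔸) (lt_min hαF (lt_min hαS (lt_min hαQ (lt_min hαA one_pos))))
  obtain ⟨Kc, hKc⟩ : ∃ K : ℝ, K = 1 + 512 * (d + 1) * (d + 4) := ⟨_, rfl⟩
  have hKc1 : 1 ≤ Kc := by
    have h0 : (0 : ℝ) ≤ 512 * (d + 1) * (d + 4) := by positivity
    rw [hKc]; linarith
  have hfin : ∀ j x : ℝ, 0 ≤ j → KF * (j + Kc * x) ≤ KF * Kc * (j + x) := fun j x hj => by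
    nlinarith [mul_nonneg (mul_nonneg hKF.le hj) (sub_nonneg.2 hKc1)]
  refine ⟨min T (α₀ / 2), j₁, ε₄, εC, Rb, Rmap, KF * Kc, lt_min hT (by positivity), hj₁, hε₄, hεC, hRb, hRmap, by positivity, ?_⟩
  intro n η _ hηL c₀ c₁ _ _ hw hc₀η hρ' m _ hm U hUG α hα0 hαle hUη hUw hpl hUgrad j₀ hJ hj' lev₀ lev₁ levB hlev hw₀ hw₁ hw₃ hwB hw₁'
  have hη0 : 0 < η := Fact.out
  have hαT' : α ≤ T := hαle.trans (min_le_left _ _)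
  have hαh : α ≤ α₀ / 2 := hαle.trans (min_le_right _ _)
  have hαle₀ : α ≤ α₀ := by linarith
  have hj0 : 0 ≤ j₀ := (norm_nonneg _).trans (hJ ⟨0, hd⟩ fun _ => 0)
  have hUS : ∀ b, U b ∈ unitaryUnits 𝔸 := fun b => by
    have h := hUG (liftSite b.1) b.2
    rwa [B9Eq315QTorus.perCfg_apply, perSite_liftSite] at h
  have hUst : ∀ b, star (U b : 𝔸) = (((U b)⁻¹ : 𝔸ˣ) : 𝔸) := forall_star_eq_inv_of_mem hUS
  have hUb : ∀ b, U b ∈ U1 𝔸 := fun b => unitaryUnits_le_U1 (hUS b)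
  have hRS := hRS_of_unitary φ τ hφτ hτ₂ U hUst
  have hη : ((L : ℝ) ^ (n + 1))⁻¹ = η := inv_eq_of_mul_eq_one_left hηL
  have h52 : pdev (perCfg (towerP L m (n + 1)) U) < α₀ * (((L : ℝ) ^ (n + 1))⁻¹) ^ 2 := by
    have hp := pdev_perCfg_le_of_plaq (U := U) hUb (by positivity) hpl
    rw [hη]
    exact lt_of_le_of_lt hp (mul_lt_mul_of_pos_right (by linarith) (by positivity))
  have hLu : ∀ (j : ℕ) (b : Bond d (towerP L m (j + 1))), star (UlevOf L m (n + 1) U j b : 𝔸) = ((UlevOf L m (n + 1) U j b)⁻¹ : 𝔸ˣ) :=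
    UlevOf_star_eq_inv L m n hL2 hUS hα₀ hα3 (by linarith) h52
  have hRlev : ∀ (j : ℕ) (b : Bond d (towerP L m (j + 1))) (w : W), ‖adTransportW φ (UlevOf L m (n + 1) U j) b w‖ ≤ ‖w‖ := fun j b w =>
    (norm_adTransportW_eq φ (UlevOf L m (n + 1) U j) τ hτ₂ (hLu j) hφτ b w).le
  obtain ⟨hβ0, hβ1, -, hUη', hpl', hUlev, εU, hεU, hUε, hεg⟩ := F m n (avgClosed_unitaryUnits d L) hUS hηL hα0 hαT' hUη hpl
  rw [← hKc] at hβ0 hβ1 hUη' hpl' hεg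
  have hβF : Kc * α ≤ αF := hβ1.trans (min_le_left _ _)
  have hβS : Kc * α ≤ αS := hβ1.trans ((min_le_right _ _).trans (min_le_left _ _))
  have hβQ : Kc * α ≤ αQ := hβ1.trans ((min_le_right _ _).trans ((min_le_right _ _).trans (min_le_left _ _)))
  have hβA : Kc * α ≤ αA := hβ1.trans ((min_le_right _ _).trans ((min_le_right _ _).trans ((min_le_right _ _).trans (min_le_left _ _))))
  have hβone : Kc * α ≤ 1 := hβ1.trans ((min_le_right _ _).trans ((min_le_right _ _).trans ((min_le_right _ _).trans (min_le_right _ _))))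
  have hαβ : α ≤ Kc * α := le_mul_of_one_le_left hα0 hKc1
  have hUgrad' : ∀ (x : TSite d (towerP L m (n + 1))) (μ : Fin d), ‖(U (x, μ) : 𝔸) - U (unshift μ x, μ)‖ ≤ Kc * α * η ^ 2 :=
    fun x μ => (hUgrad x μ).trans (mul_le_mul_of_nonneg_right hαβ (by positivity))
  have hUw' : ∀ (x : TSite d (towerP L m (n + 1))) (μ ν : Fin d), ‖(U (shift ν x, μ) : 𝔸) - (U (x, μ) : 𝔸)‖ ≤ Kc * α * η ^ 2 :=
    fun x μ ν => (hUw x μ ν).trans (mul_le_mul_of_nonneg_right hαβ (by positivity))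
  have hα0' : ∀ j, 0 ≤ αT d L α₀ * (((L : ℝ) ^ min (j + 1) (n + 1))⁻¹) ^ 2 := geomProfile_nonneg (d := d) L (n + 1) hα₀.le
  have hαL' : ∀ j, 50 * (d + 1) * (αT d L α₀ * (((L : ℝ) ^ min (j + 1) (n + 1))⁻¹) ^ 2) * (L : ℝ) ^ d ≤ 1 / 2 := fun j =>
    le_trans (mul_le_mul_of_nonneg_right (mul_le_mul_of_nonneg_left (geomProfile_le_αT (d := d) L (n + 1) hL hα₀.le j) (by positivity))
      (by positivity)) hαL
  have hAQ : ∑ j ∈ Finset.range (n + 1), αT d L α₀ * (((L : ℝ) ^ min (j + 1) (n + 1))⁻¹) ^ 2 ≤ αT d L α₀ / 3 :=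
    sum_geomProfile_le (d := d) L (n + 1) hL2 hα₀.le
  -- the levels `ε_j ≤ 1`: below the top by the feed (`Kα ≤ 1`); at and above the top the level background is `U` itself
  have hη1 : η ≤ 1 := by
    have h1 : (1 : ℝ) ≤ (L : ℝ) ^ (n + 1) := one_le_pow₀ hL1
    nlinarith [hηL, hη0]
  have hKα1 : Kc * α * 1 ≤ 1 := by rw [mul_one]; exact hβone
  have hUε' : ∀ (j : ℕ) (bb : Bond d (towerP L m (j + 1))), ‖(UlevOf L m (n + 1) U j bb : 𝔸) - 1‖ ≤ min (εU j) 1 := fun j bb => by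
    refine le_min (hUε j bb) ?_
    rcases Nat.lt_or_ge j (n + 1) with hj | hj
    · exact (hUε j bb).trans ((hεg j hj).trans ((mul_le_mul_of_nonneg_left (pow_le_one₀ hr0 hr1.le) hβ0).trans hKα1))
    · have h0 : n + 1 - 1 - j = 0 := by omega
      have e : (UlevOf L m (n + 1) U j bb : 𝔸) = U (perSite (towerP L m (n + 1)) (liftSite bb.1), bb.2) := by
        simp only [UlevOf, h0, avgIter_zero, perCfg_apply]
      rw [e]
      exact (hUη _).trans ((mul_le_mul hαβ hη1 hη0.le hβ0).trans hKα1)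
  have hεU' : ∀ j, 0 ≤ min (εU j) 1 := fun j => le_min (hεU j) zero_le_one
  have hε1' : ∀ j, min (εU j) 1 ≤ 1 := fun j => min_le_right _ _
  have hεg' : ∀ j < n + 1, min (εU j) 1 ≤ Kc * α * (1 / (L : ℝ)) ^ j := fun j hj => (min_le_left _ _).trans (hεg j hj)
  have hpos' : ∀ x : SiteL2K ℂ d (towerP L m (n + 1)) c₀ W, x ≠ 0 →
      0 < RCLike.re ⟪x, laplacePrimeAk L m n φ η U a' (c₁ := c₁) x⟫_ℂ := fun x hx => by
    have h := HS n η hηL c₀ c₁ hw m U hRS _ hβ0 hβS hUb hUη' εU hεU hεg hUε hUlev x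
    have hx' : 0 < ‖x‖ := norm_pos_iff.2 hx
    have h2 : 0 < γ' * (‖covDerivL2K ℂ c₀ ((η : ℂ))⁻¹ (adTransportW φ (fun _ : Bond d (towerP L m (n + 1)) => (1 : 𝔸ˣ))) x‖ ^ 2 +
        ‖x‖ ^ 2) := mul_pos hγ' (add_pos_of_nonneg_of_pos (sq_nonneg _) (pow_pos hx' 2))
    linarith
  have hposπ : ∀ x : BondL2K ℂ d (towerP L m (n + 1)) c₀ W, x ≠ 0 →
      0 < RCLike.re ⟪x, laplaceAkPi L m n φ τ η U a' hpos' hL (fun j => αT d L α₀ * (((L : ℝ) ^ min (j + 1) (n + 1))⁻¹) ^ 2)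
        (fun j => (geomProfile_le_αT (d := d) L (n + 1) hL hα₀.le j).trans (αT_le hL hα4))
        (ulev_mem_U1_of_pdev L m (n + 1) U hL2 (avgClosed_unitaryUnits d L) hUG hα₀ hα3 hα4 h52)
        (ulev_reg_of_pdev_geometric L m (n + 1) U hL2 (avgClosed_unitaryUnits d L) hUG hα₀ hα3 hα4 h52) (c₁ := c₁) a x⟫_ℂ := fun x hx =>
    HQ n η hηL c₀ c₁ hw hρ' m U _ _ _ _ εU hεU hUε hβ0 hβQ hRS hUb hUη' hpl' hεg hUlev hpos' x hx
  have hpos : ∀ x : BondL2K ℂ d (towerP L m (n + 1)) c₀ W, x ≠ 0 →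
      0 < RCLike.re ⟪x, laplaceAk L m n φ η U hL (fun j => αT d L α₀ * (((L : ℝ) ^ min (j + 1) (n + 1))⁻¹) ^ 2)
        (fun j => (geomProfile_le_αT (d := d) L (n + 1) hL hα₀.le j).trans (αT_le hL hα4))
        (ulev_mem_U1_of_pdev L m (n + 1) U hL2 (avgClosed_unitaryUnits d L) hUG hα₀ hα3 hα4 h52)
        (ulev_reg_of_pdev_geometric L m (n + 1) U hL2 (avgClosed_unitaryUnits d L) hUG hα₀ hα3 hα4 h52) τ (c₀ := c₀) (c₁ := c₁) a x⟫_ℂ :=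
    fun x hx => HA n η hηL c₀ c₁ hw hρ' m U _ _ _ _ εU hεU hUε hβ0 hβA hRS hUb hUη' hpl' hεg x hx
  -- the vacuum is in the class at `α = 0`: its data and its two positivity witnesses (the chain's letters; `Q_k(1)` onto by `QkW_one_surjective`)
  have hUst1 : ∀ b' : Bond d (towerP L m (n + 1)), star ((fun _ : Bond d (towerP L m (n + 1)) => (1 : 𝔸ˣ)) b' : 𝔸) =
      ((((fun _ : Bond d (towerP L m (n + 1)) => (1 : 𝔸ˣ)) b')⁻¹ : 𝔸ˣ) : 𝔸) := fun _ => by simp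
  have hUb1 : ∀ b' : Bond d (towerP L m (n + 1)), (fun _ : Bond d (towerP L m (n + 1)) => (1 : 𝔸ˣ)) b' ∈ U1 𝔸 := fun _ => one_mem _
  have hUη1 : ∀ b' : Bond d (towerP L m (n + 1)), ‖(((fun _ : Bond d (towerP L m (n + 1)) => (1 : 𝔸ˣ)) b' : 𝔸ˣ) : 𝔸) - 1‖ ≤ 0 * η := fun _ => by simp
  have hpl1 : ∀ p : B9SectCLatticeCarrier.Plaq d (towerP L m (n + 1)), ‖(plaqHolU (fun _ : Bond d (towerP L m (n + 1)) => (1 : 𝔸ˣ)) p : 𝔸) - 1‖ ≤ 0 * η ^ 2 :=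
    fun p => by rw [plaqHolU_one, Units.val_one, sub_self, norm_zero, zero_mul]
  have hUε1 : ∀ (j : ℕ) (b' : Bond d (towerP L m (j + 1))),
      ‖(UlevOf L m (n + 1) (fun _ : Bond d (towerP L m (n + 1)) => (1 : 𝔸ˣ)) j b' : 𝔸) - 1‖ ≤ (fun _ : ℕ => (0 : ℝ)) j := fun j b' => by rw [UlevOf_one]; simp
  have hLb1 : ∀ (j : ℕ) (b' : Bond d (towerP L m (j + 1))), UlevOf L m (n + 1) (fun _ : Bond d (towerP L m (n + 1)) => (1 : 𝔸ˣ)) j b' ∈ U1 𝔸 :=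
    fun j b' => by rw [UlevOf_one]; exact one_mem _
  have hεg1 : ∀ j < n + 1, (fun _ : ℕ => (0 : ℝ)) j ≤ 0 * (1 / (L : ℝ)) ^ j := fun _ _ => by simp
  have hRS1 := hRS_of_unitary φ τ hφτ hτ₂ (fun _ : Bond d (towerP L m (n + 1)) => (1 : 𝔸ˣ)) hUst1
  have hpos'₁ : ∀ x : SiteL2K ℂ d (towerP L m (n + 1)) c₀ W, x ≠ 0 →
      0 < RCLike.re ⟪x, laplacePrimeAk L m n φ η (fun _ : Bond d (towerP L m (n + 1)) => (1 : 𝔸ˣ)) a' (c₁ := c₁) x⟫_ℂ := fun x hx => by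
    have h := HS n η hηL c₀ c₁ hw m (fun _ : Bond d (towerP L m (n + 1)) => (1 : 𝔸ˣ)) hRS1 0 le_rfl hαS.le hUb1 hUη1 (fun _ => 0) (fun _ => le_rfl)
      hεg1 hUε1 hLb1 x
    have hx' : 0 < ‖x‖ := norm_pos_iff.2 hx
    have h2 : 0 < γ' * (‖covDerivL2K ℂ c₀ ((η : ℂ))⁻¹ (adTransportW φ (fun _ : Bond d (towerP L m (n + 1)) => (1 : 𝔸ˣ))) x‖ ^ 2 +
        ‖x‖ ^ 2) := mul_pos hγ' (add_pos_of_nonneg_of_pos (sq_nonneg _) (pow_pos hx' 2))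
    linarith
  have hpos₁ : ∀ x : BondL2K ℂ d (towerP L m (n + 1)) c₀ W, x ≠ 0 →
      0 < RCLike.re ⟪x, laplaceAk L m n φ η (fun _ : Bond d (towerP L m (n + 1)) => (1 : 𝔸ˣ)) hL (fun _ => 0) (fun _ => by norm_num)
        (perCfg_UlevOf_one_mem_U1 L m (n + 1)) (norm_Wcx_UlevOf_one_sub_one_le L m (n + 1) (fun _ => 0) (fun _ => le_rfl)) τ
        (c₀ := c₀) (c₁ := c₁) a x⟫_ℂ := fun x hx =>
    HA n η hηL c₀ c₁ hw hρ' m (fun _ : Bond d (towerP L m (n + 1)) => (1 : 𝔸ˣ)) (fun _ => 0) (fun _ => by norm_num)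
      (perCfg_UlevOf_one_mem_U1 L m (n + 1)) (norm_Wcx_UlevOf_one_sub_one_le L m (n + 1) (fun _ => 0) (fun _ => le_rfl)) (fun _ => 0) (fun _ => le_rfl)
      hUε1 le_rfl hαA.le hRS1 hUb1 hUη1 hpl1 hεg1 x hx
  refine ⟨h52, hpos', hposπ, hpos₁, ?_⟩
  have hΩ₀ : (NegSup.wInvSup (levWeight (L : ℝ) η lev₀ 1) : ℝ) ≤ Ω := by
    have h : NegSup.wInvSup (levWeight (L : ℝ) η lev₀ 1) ≤ 1 :=
      Finset.sup_le fun b _ => by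
        refine inv_le_one_of_one_le₀ ?_
        rw [← NNReal.coe_le_coe, NegSup.coe_wNN (w := levWeight (L : ℝ) η lev₀ 1), levWeight_apply, pow_one, NNReal.coe_one]
        calc (1 : ℝ) = (L : ℝ) ^ (n + 1) * η := by rw [mul_comm]; exact hηL.symm
          _ ≤ (L : ℝ) ^ lev₀ b * η := mul_le_mul_of_nonneg_right (pow_le_pow_right₀ hL1 (hlev b)) hη0.le
    have h' : ((NegSup.wInvSup (levWeight (L : ℝ) η lev₀ 1) : NNReal) : ℝ) ≤ 1 := by exact_mod_cast h
    exact h'.trans hΩ1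
  have hK0' : (0 : ℝ) < (L : ℝ) ^ (n + 1) := by positivity
  have e7E : epsCplx d L (r' / (L : ℝ) ^ (n + 1)) (n + 1) = epsCplx d L r' 0 := by
    unfold epsCplx; rw [pow_zero, one_mul, mul_div_cancel₀ _ hK0'.ne']
  have e7X : tauCplx d L α₀ (n + 1) (r' / (L : ℝ) ^ (n + 1)) (n + 1) = tauCplx d L α₀ 0 r' 0 := by
    unfold tauCplx; rw [mul_inv_cancel₀ hK0'.ne', mul_div_cancel₀ _ hK0'.ne']; norm_num
  have h7E' : epsCplx d L (r' / (L : ℝ) ^ (n + 1)) (n + 1) ≤ 1 / 16 := by rw [e7E]; exact h7E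
  have h7dX' : (d : ℝ) * (epsCplx d L (r' / (L : ℝ) ^ (n + 1)) (n + 1) + tauCplx d L α₀ (n + 1) (r' / (L : ℝ) ^ (n + 1)) (n + 1)) ≤ 1 / 16 := by
    rw [e7E, e7X]; exact h7dX
  have hτc2 : ∀ a b : 𝔸, LinearMap.toContinuousLinearMap τ (a * b) = LinearMap.toContinuousLinearMap τ (b * a) := fun a b => hτ₂ a b
  have hτcs : ∀ a : 𝔸, LinearMap.toContinuousLinearMap τ (star a) = starRingEnd ℂ (LinearMap.toContinuousLinearMap τ a) := fun a => hτ₁ a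
  have hτc1 : ∀ X : 𝔸, ‖LinearMap.toContinuousLinearMap τ X‖ ≤ ‖X‖ := fun X =>
    (hτ X).trans (mul_le_of_le_one_left (norm_nonneg X) hCτ1)
  have hτn : ‖LinearMap.toContinuousLinearMap τ‖ ≤ 1 :=
    ContinuousLinearMap.opNorm_le_bound _ zero_le_one fun X => by simpa only [one_mul] using hτc1 X
  have hρn : ‖rieszτ (𝔸 := 𝔸) φ‖ ≤ Mφ * Mφ := by
    refine ContinuousLinearMap.opNorm_le_bound _ (mul_nonneg hMφ hMφ) fun ℓ => ?_
    have hφL : ‖(haveI : FiniteDimensional ℂ 𝔸 := LinearEquiv.finiteDimensional φ;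
        LinearMap.toContinuousLinearMap φ.toLinearMap)‖ ≤ Mφ :=
      ContinuousLinearMap.opNorm_le_bound _ hMφ fun w => by simpa using hφ w
    rw [rieszτ_apply, norm_star]
    calc ‖φ ((InnerProductSpace.toDual ℂ W).symm (ℓ.comp (haveI : FiniteDimensional ℂ 𝔸 := LinearEquiv.finiteDimensional φ;
            LinearMap.toContinuousLinearMap φ.toLinearMap)))‖
        ≤ Mφ * ‖(InnerProductSpace.toDual ℂ W).symm (ℓ.comp (haveI : FiniteDimensional ℂ 𝔸 := LinearEquiv.finiteDimensional φ;
            LinearMap.toContinuousLinearMap φ.toLinearMap))‖ := hφ _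
      _ = Mφ * ‖ℓ.comp (haveI : FiniteDimensional ℂ 𝔸 := LinearEquiv.finiteDimensional φ;
            LinearMap.toContinuousLinearMap φ.toLinearMap)‖ := by rw [LinearIsometryEquiv.norm_map]
      _ ≤ Mφ * (‖ℓ‖ * ‖(haveI : FiniteDimensional ℂ 𝔸 := LinearEquiv.finiteDimensional φ;
            LinearMap.toContinuousLinearMap φ.toLinearMap)‖) := by
          gcongr; exact ContinuousLinearMap.opNorm_comp_le _ _
      _ ≤ Mφ * (‖ℓ‖ * Mφ) := by gcongr
      _ = Mφ * Mφ * ‖ℓ‖ := by ring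
  have hω0 : 0 < ω := by linarith
  have hΩ0 : 0 < Ω := by linarith
  have hqV : ∀ Y : Space115 (L : ℝ) η lev₀ lev₁ (nabla115 η U), ‖Y‖ < 1 / 16 →
      ‖curV0 (lev₁ := lev₁) (Dc := nabla115 η U) (rieszτ φ) (LinearMap.toContinuousLinearMap τ) U Y‖ ≤ CV * ‖Y‖ ^ 2 := by
    intro Y hY
    refine (curV0_quadBound_lattice_uniform (L := (L : ℝ)) (η := η) (lev₀ := lev₀) (lev₁ := lev₁) (rieszτ φ)
      (LinearMap.toContinuousLinearMap τ) hτc2 hτcs hτc1 hL1 hUb hUst hα0 hpl hω1 hΩ1 hw₀ hΩ₀ hw₁' Y hY).trans ?_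
    rw [hCVdef]
    gcongr
  have hqV₁ : ∀ Y : Space115 (L : ℝ) η lev₀ lev₁ (nabla115 η (fun _ : Bond d (towerP L m (n + 1)) => (1 : 𝔸ˣ))), ‖Y‖ < 1 / 16 →
      ‖curV0 (lev₁ := lev₁) (Dc := nabla115 η (fun _ : Bond d (towerP L m (n + 1)) => (1 : 𝔸ˣ))) (rieszτ φ) (LinearMap.toContinuousLinearMap τ)
        (fun _ : Bond d (towerP L m (n + 1)) => (1 : 𝔸ˣ)) Y‖ ≤ CV * ‖Y‖ ^ 2 := by
    intro Y hY
    refine (curV0_quadBound_lattice_uniform (L := (L : ℝ)) (η := η) (lev₀ := lev₀) (lev₁ := lev₁) (rieszτ φ)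
      (LinearMap.toContinuousLinearMap τ) hτc2 hτcs hτc1 hL1 hUb1 hUst1 le_rfl hpl1 hω1 hΩ1 hw₀ hΩ₀ hw₁' Y hY).trans ?_
    rw [hCVdef]
    gcongr
  have hwb : ∀ b, levWeight (L : ℝ) η lev₀ 1 b ≤ ω := fun b => (NegSup.le_wSup (w := levWeight (L : ℝ) η lev₀ 1) b).trans hw₀
  have hJn : ‖Jcur (L := (L : ℝ)) (η := η) (lev₀ := lev₀) U‖ ≤ ω ^ 3 * j₀ :=
    norm_Jcur_le_of_window (𝔸 := 𝔸) (L : ℝ) U hj0 (by positivity) (levWeight_three_le (L : ℝ) hwb) hJ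
  have hJn1 : ‖Jcur (L := (L : ℝ)) (η := η) (lev₀ := lev₀) (fun _ : Bond d (towerP L m (n + 1)) => (1 : 𝔸ˣ))‖ ≤ ω ^ 3 * j₀ :=
    (norm_Jcur_le_of_window (𝔸 := 𝔸) (L : ℝ) (fun _ : Bond d (towerP L m (n + 1)) => (1 : 𝔸ˣ)) le_rfl (by positivity) (levWeight_three_le (L : ℝ) hwb)
      (J_flat_le_zero L m n η (𝔸 := 𝔸))).trans (by rw [mul_zero]; positivity)
  -- the Lit package at the produced block (`α := Kα`), handed out; the Lipschitz member with `K·(j₀ + Kα) ≤ K·K_c·(j₀ + α)`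
  obtain ⟨CG, C₄, R'w, jr, ar, aC, hjr, har, hcap, hR'a, hRm, R₁, R₂, RC₁, RC₂, hBU, hB1, HL⟩ := HF n η hηL c₀ c₁ hw hρ' m hm U _ hα0' _ hαL' _ _
    (fun j => min (εU j) 1) hεU' hε1' hUε' hUlev (Kc * α) hβ0 hβF hUst hUb hUη' hUw' hpl' hUgrad' hRlev hεg' hAQ hpos' hpos hc₀η j₀ hJ hj' hposπ _ hpos'₁ hpos₁
    (QkW_one_surjective L m hL n φ) hUG lev₀ levB lev₁ hlev hw₀ hw₁ hΩ₀ hw₃ hwB hw₁' h7E' h7dX' hLu (rieszτ φ) hρn (Jcur (L := (L : ℝ)) (η := η) (lev₀ := lev₀) U)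
    (Jcur (L := (L : ℝ)) (η := η) (lev₀ := lev₀) (fun _ : Bond d (towerP L m (n + 1)) => (1 : 𝔸ˣ))) hJn hJn1 hqV hqV₁
  exact ⟨CG, C₄, R'w, jr, ar, aC, hjr, har, hcap, hR'a, hRm, R₁, R₂, RC₁, RC₂, hBU, hB1, fun B hBb => (HL B hBb).trans (hfin j₀ α hj0)⟩

end Literature.MathematicalPhysics.QuantumFieldTheory.Balaban1983to89.B11Eq174ChartRegimesLipschitzAtFlatW80UnitaryClass

end
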